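import Literature.IUT.HodgeArakelov.AbsTopMonoidsNonVacuityAug
import Literature.IUT.HodgeArakelov.KummerStructures
import Literature.IUT.HodgeArakelov.Prop13ToyModel
import Literature.IUT.HodgeTheaters.ZHatIntegersInjective
import Literature.IUT.HodgeTheaters.DiscreteProfiniteCompletionsProofs
import HarnessLib

/-!
# [IUTchII] Remark 1.8.1 as a SCHEMA over the interface `AbsTopMonoids S` (FACT-LIST row F-0414):
# ∀-closure REFUTED at a toy interface instance, INHABITED (vacuously) at the degenerate instance

PROOF-ONLY companion (0 `def`, 0 `instance`, 0 notation; the two interface instances are built inside the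
theorem terms) of the abc-iut cell, block F (seat abc-iut-f-135, gen 8; director-abc g4 ROW SUPPLY
`ROWS-LF-0348.tsv` row 7 «decide the label»; abc-iut-f-130 g7 residual census). It imports — never edits —
abc-iut-L6-t1's `AbsTopInterfaces` (`Rmk181_statement A`: "no automorphism of `O^{×μ}(G)` induced by an element of
`Aut(G)` coincides with an automorphism of `O^{×μ}(G)` induced by an element of `Γ` that has nontrivial image in
`ℤ_p^×`", typed over the INTERFACE `AbsTopMonoids S` of Example 1.8 (ii)–(ix)), abc-iut-w5-d114/w5-d105's
non-vacuity kit (`AbsTopMonoids.degenerate`, `deltaOf`, `quotDeltaOfIso`, `quotDeltaX_iso_of_isOpenMap`), the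
Kummer-structure plumbing `actionModTorsion` (automorphisms descend to units mod torsion), the toy setting
`Prop13Toy.setting` (`Π^tp := Ẑ =: G_k`, `aug := id`) and `ℤ ↪ ℤ̂` (`toCompletion_int_injective`).

* `not_forall_rmk181_statement` — at `S := Prop13Toy.setting` the interface admits the instance with ALL monoids
  `O^⊳(G) := M_TM(Π) := Ẑ` (trivial `G`-actions), transport `mapOtri f :=` the automorphism of `Ẑ = G_k` obtained by
  conjugating `f : G ≅ G*` with chosen isomorphisms `G ≅ G_k ≅ G*`, and `Ism(G) := Ẑ^× = Aut(Ẑ)` acting on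
  `O^{×μ}(G) = Ẑ^×/torsion` through its tautological action on `Ẑ` (`toIsm := id`). There the `Aut(G)`-induced
  automorphism of `O^{×μ}(G)` for `σ :=` inversion on `G := G_k` IS the `Ism`-action of `γ := mapOtri σ = (·)⁻¹ ∈ Ẑ^×`,
  which is nontrivial on `Ẑ^×/torsion` (`1 ∈ ℤ ⊆ Ẑ` has infinite order) — so the typed Remark FAILS for this `A`:
  the ∀-closure over `(S, A)` is REFUTED. The interface does not tie `Ism(G)`/`mapOtri` to the genuine
  [AbsTopIII] monoids, which is exactly what the Remark's printed proof uses (the `p`-adic logarithm of the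
  cyclotomic character); the row's content is per-instance (`rmk181_genuineOfModelIsm(_of_normCompat)`,
  `exists_allGenuine_rmk181_ofDoubleUnderlinePadic_modelχq`, by name — untouched).
* `exists_rmk181_statement` — INHABITED: at the DEGENERATE instance (`Ism(G)` trivial) the Remark holds vacuously.

HONEST FRAMING: certificates about OUR interface typing at toy data; nothing here bears on [AbsTopIII], on the
genuine monoids, on [IUTchIII] Cor. 3.12, and no side is taken on any author. A FACT row is an assumption label on
OUR typed statement; typed ≠ proved. [claim: Mochizuki2012, status: disputed] (IUTchII §1 Rmk 1.8.1, kurims pp.41-42)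
-/

noncomputable section

namespace Literature.IUT.HodgeArakelov

open Literature.IUT.HodgeTheaters

/-! ## F-0414 `Rmk181_statement` -/

/-- **F-0414, INHABITED (vacuously) at the degenerate interface instance** over `Prop13Toy.setting`: with
`Ism(G)` trivial no isometry acts nontrivially, so the typed Remark 1.8.1 holds.
[claim: Mochizuki2012, status: disputed] (IUTchII §1 Rmk 1.8.1, kurims pp.41-42) -/
theorem exists_rmk181_statement :
    ∃ (S : ThetaSetting.{0}) (A : AbsTopMonoids S), Rmk181_statement A := by
  let S : ThetaSetting.{0} := Prop13Toy.setting
  have hbot : S.DeltaX = ⊥ := MonoidHom.ker_id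
  have hΔ : ∀ f : S.PiX ≃ₜ* S.PiX, S.DeltaX.map f.toMulEquiv.toMonoidHom = S.DeltaX := fun f => by
    rw [hbot, Subgroup.map_bot]
  have hq := AbsTopMonoids.quotDeltaX_iso_of_isOpenMap S IsOpenMap.id
  exact ⟨S, AbsTopMonoids.degenerate hΔ hq, fun G σ γ hne => (hne rfl).elim⟩

/-- **F-0414, ∀-closure REFUTED**: over `Prop13Toy.setting` (`Π^tp = G_k = Ẑ`, `aug = id`) the interface instance
with `O^⊳(G) := Ẑ`, transport by conjugation with chosen isomorphisms `G ≅ Ẑ`, and `Ism(G) := Aut(Ẑ) = Ẑ^×` acting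
tautologically: for `σ :=` inversion on `G_k` the `Aut(G)`-induced automorphism of `O^{×μ}(G) = Ẑ^×/torsion` equals
the `Ism`-action of `γ := (·)⁻¹ ∈ Ẑ^×`, nontrivial since `Ẑ ⊇ ℤ` is not `2`-torsion.
[claim: Mochizuki2012, status: disputed] (IUTchII §1 Rmk 1.8.1, kurims pp.41-42) -/
theorem not_forall_rmk181_statement :
    ¬ ∀ (S : ThetaSetting.{0}) (A : AbsTopMonoids S), Rmk181_statement A := by
  intro hall
  let S : ThetaSetting.{0} := Prop13Toy.setting
  letI : CommGroup Prop13Toy.Zh := { mul_comm := ZHat.mul_comm }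
  have hbot : S.DeltaX = ⊥ := MonoidHom.ker_id
  have hΔ : ∀ f : S.PiX ≃ₜ* S.PiX, S.DeltaX.map f.toMulEquiv.toMonoidHom = S.DeltaX := fun f => by
    rw [hbot, Subgroup.map_bot]
  have hq := AbsTopMonoids.quotDeltaX_iso_of_isOpenMap S IsOpenMap.id
  -- chosen isomorphisms `G ≅ G_k = Ẑ` for the isomorphs of `G_k`
  let cG : ∀ X : IsoClass S.Gk, X.G ≃ₜ* S.Gk := fun X => Classical.choice X.iso
  -- `Aut(Ẑ) ↷ Ẑ^×`
  let uA : MulAut Prop13Toy.Zh →* MulAut (Prop13Toy.Zh)ˣ :=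
    { toFun := fun γ => Units.mapEquiv γ
      map_one' := by ext u; simp [Units.coe_mapEquiv]
      map_mul' := fun γ γ' => by ext u; simp [Units.coe_mapEquiv] }
  let A : AbsTopMonoids S :=
    { Otri := fun _ => Prop13Toy.Zh
      actOtri := fun _ => 1
      mapOtri := fun {X Y} f => ((cG X).symm.trans ((IsoClass.homIso f).trans (cG Y))).toMulEquiv
      mapOtri_id := fun X => by
        apply MulEquiv.ext
        intro x
        exact (cG X).apply_symm_apply x
      mapOtri_comp := fun {X Y Z} f g => by
        apply MulEquiv.ext
        intro x
        show (cG Z) (IsoClass.homIso g (IsoClass.homIso f ((cG X).symm x))) =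
          (cG Z) (IsoClass.homIso g ((cG Y).symm ((cG Y) (IsoClass.homIso f ((cG X).symm x)))))
        rw [(cG Y).symm_apply_apply]
      mapOtri_equivariant := fun f g m => by simp
      MTM := fun _ => Prop13Toy.Zh
      actMTM := fun _ => 1
      mapMTM := fun _ => MulEquiv.refl _
      mapMTM_id := fun _ => rfl
      mapMTM_comp := fun _ _ => MulEquiv.ext fun _ => rfl
      mapMTM_equivariant := fun f g m => by simp
      Delta := fun P => AbsTopMonoids.deltaOf P
      Delta_map := fun f => AbsTopMonoids.deltaOf_map hΔ f
      Delta_base := AbsTopMonoids.deltaOf_base hΔ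
      quotIso := fun P => ⟨(AbsTopMonoids.quotDeltaOfIso P).trans (Classical.choice hq)⟩
      tauto := fun _ => MulEquiv.refl _
      tauto_equivariant := fun P x m => by simp
      Ism := fun _ => MulAut Prop13Toy.Zh
      actIsm := fun _ => actionModTorsion uA
      toIsm := fun _ => MonoidHom.id _ }
  -- the base object `G := G_k` and the inversion automorphism `σ` of the commutative topological group `Ẑ`
  let G : IsoClass S.Gk := IsoClass.base S.Gk
  let σ : G ⟶ G :=
    ({ MulEquiv.inv Prop13Toy.Zh with
        continuous_toFun := continuous_inv
        continuous_invFun := continuous_inv } : Prop13Toy.Zh ≃ₜ* Prop13Toy.Zh)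
  let γ : MulAut Prop13Toy.Zh := A.mapOtri σ
  -- `γ` is inversion
  have hγ : ∀ z : Prop13Toy.Zh, γ z = z⁻¹ := fun z => by
    show (cG G) (((cG G).symm z)⁻¹) = z⁻¹
    rw [map_inv, (cG G).apply_symm_apply]
  have h := hall S A G σ γ
  -- (1) the `Aut(G)`-induced and the `Ism`-induced automorphisms of `O^{×μ}(G)` AGREE (by construction)
  have hagree : ∀ x : A.Ounits G,
      (QuotientGroup.mk (Units.map (A.mapOtri σ).toMonoidHom x) : A.Oxmu G) =
        A.actIsm G (A.toIsm G γ) (QuotientGroup.mk x) := by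
    intro x
    show (QuotientGroup.mk (Units.map γ.toMonoidHom x) : A.Oxmu G) =
      actionModTorsion uA γ (QuotientGroup.mk x)
    rw [actionModTorsion_mk]
    congr 1
  -- (2) the `Ism`-action of `γ` is NONTRIVIAL on `Ẑ^×/torsion`: `[z⁻¹] ≠ [z]` for `z = 1 ∈ ℤ ⊆ Ẑ`
  refine h ?_ hagree
  intro htriv
  let z : Prop13Toy.Zh := toCompletion (Multiplicative ℤ) (Multiplicative.ofAdd 1)
  let u : (Prop13Toy.Zh)ˣ := toUnits z
  have hu : A.actIsm G (A.toIsm G γ) (QuotientGroup.mk u : A.Oxmu G) = QuotientGroup.mk u := by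
    rw [htriv]; rfl
  have hu' : (QuotientGroup.mk (uA γ u) : A.Oxmu G) = QuotientGroup.mk u := by
    rw [← hu]
    exact (actionModTorsion_mk uA γ u).symm
  have hinv : uA γ u = u⁻¹ := by
    ext
    show γ (u : Prop13Toy.Zh) = ((u⁻¹ : (Prop13Toy.Zh)ˣ) : Prop13Toy.Zh)
    rw [hγ, Units.val_inv_eq_inv_val]
  rw [hinv, QuotientGroup.eq, inv_inv, CommGroup.mem_torsion, isOfFinOrder_iff_pow_eq_one] at hu'
  obtain ⟨n, hn, hpow⟩ := hu'
  have hz : z ^ (2 * n) = 1 := by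
    have := congrArg (fun v : (Prop13Toy.Zh)ˣ => (v : Prop13Toy.Zh)) hpow
    simpa [u, pow_mul, sq] using this
  have hz' : (Multiplicative.ofAdd (1 : ℤ)) ^ (2 * n) = 1 := by
    apply toCompletion_int_injective
    rw [map_pow, MonoidHom.map_one]
    exact hz
  have := congrArg Multiplicative.toAdd hz'
  simp at this
  omega

end Literature.IUT.HodgeArakelov

end
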